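import Summits.CriticalPhenomena.PercolationContinuityZ3.Theorems.PercTreeValueAssembly
import Summits.CriticalPhenomena.PercolationContinuityZ3.Theorems.PercTreeValueConnectionPatternFactorisation

/-!
# `TetrahedronHarrisGap` (stmt-CriticalPhenomena-7799) — STRENGTH certificate of the crux

Route `PercTreeValue`, rank-3 crux: the uniform strict Harris inequality
`(1+δ) τ(0,a_r) τ(b_r,c_r) ≤ P_{p_c}(0 ↔ a_r ∧ b_r ↔ c_r)` for the two opposite edges of the regular lattice tetrahedron
`T_r = (0, (r,r,0), (r,0,r), (0,r,r))` of `ℤ³`.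

This file records, as tree theorems and BY NAME, how strong the crux is relative to the sub-problem
`PercolationContinuityZ3` (`θ(p_c(ℤ³)) = 0`) — the evidence a strength tribunal (D-0033, T1) and the redirect strategist
r1 (`Cruxes/TetrahedronHarrisGap/STRATEGY-CENSUS.md`, Part A) refer to:

* `percolationContinuityZ3_of_tetrahedronHarrisGap` — the crux ALONE implies the conjunct: the landed assembly
  `percTreeValue_assembly_proof` (item 7806) fed with the landed pattern-blindness theorem
  `connectionPatternFactorisation_proof` (item 7802).  Hence any proof of the crux from inputs `X₁ ∧ … ∧ X_k` is a proof
  of `θ(p_c) = 0` from the same inputs: at least one input is continuity-strength.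
* `not_tetrahedronHarrisGap_of_theta_ne_zero` — contrapositive: in a jump world the crux is FALSE (asymptotic Harris
  EQUALITY).  Every all-graph / all-`p` tool (Harris–FKG, BK/Reimer, vdB–Kesten-type conditional inequalities, the pairing
  bound `H ≤ 3`, the exact identities `H = Ψ + d`, noise interpolation, total covariance) is valid verbatim when
  `θ(p_c) > 0`, so no argument built from those alone can prove the crux.
* `tetrahedronHarrisGap_iff_continuity_and_residual` — `crux ⟺ conjunct ∧ (conjunct → crux)`: the crux is the
  sub-problem PLUS a residual (the amplitude statement given continuity) and nothing else.  The residual is not expected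
  to follow from `θ(p_c) = 0`: in the decided high-dimensional regime `θ(p_c) = 0` holds while the analogue of the crux
  fails (`H_r → 1`; tree-graph bound with `η = 0`, cf. `Literature.Barriers.CriticalPhenomena.SpanningClustersAboveSix`).

Pure glue; nothing here is conditional on an unproved named fact.
-/

namespace Summit.CriticalPhenomena.PercolationContinuityZ3.Theorems.TetrahedronHarrisGap.Cert

open Literature.Probability.Percolation Literature.Probability.LatticeModels
open Summit.CriticalPhenomena.PercolationContinuityZ3.Theses.PercTreeValue

/-- **The crux implies the conjunct.** `TetrahedronHarrisGap → θ(p_c(ℤ³)) = 0`, by the landed items 7806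
(`percTreeValue_assembly_proof : ConnectionPatternFactorisation → TetrahedronHarrisGap → PercolationContinuityZ3`) and
7802 (`connectionPatternFactorisation_proof`). [folklore] -/
theorem percolationContinuityZ3_of_tetrahedronHarrisGap :
    TetrahedronHarrisGap → _root_.PercolationContinuityZ3 := by
  intro h
  have hA := Summit.CriticalPhenomena.PercolationContinuityZ3.Theorems.percTreeValue_assembly_proof
  unfold Summit.CriticalPhenomena.PercolationContinuityZ3.Theses.PercTreeValue.Assembly at hA
  exact hA Summit.CriticalPhenomena.PercolationContinuityZ3.Theorems.connectionPatternFactorisation_proof h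

/-- **A jump kills the crux.** If `θ(p_c) ≠ 0` on `ℤ³` then there is no uniform strict Harris gap for the opposite
edges of the lattice tetrahedron (contrapositive of `percolationContinuityZ3_of_tetrahedronHarrisGap`). [folklore] -/
theorem not_tetrahedronHarrisGap_of_theta_ne_zero :
    theta (zdGraph 3) (0 : Site 3) (criticalProbI 3) ≠ 0 → ¬ TetrahedronHarrisGap :=
  fun hθ h => hθ (percolationContinuityZ3_iff.mp (percolationContinuityZ3_of_tetrahedronHarrisGap h))

/-- **Crux = conjunct + residual.** `TetrahedronHarrisGap ⟺ PercolationContinuityZ3 ∧ (PercolationContinuityZ3 →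
TetrahedronHarrisGap)`.  One direction is `percolationContinuityZ3_of_tetrahedronHarrisGap`, the rest is logic; the
content is that the residual `PercolationContinuityZ3 → TetrahedronHarrisGap` is the ONLY thing the crux adds to the
sub-problem. [folklore] -/
theorem tetrahedronHarrisGap_iff_continuity_and_residual :
    TetrahedronHarrisGap ↔
      (_root_.PercolationContinuityZ3 ∧ (_root_.PercolationContinuityZ3 → TetrahedronHarrisGap)) :=
  ⟨fun h => ⟨percolationContinuityZ3_of_tetrahedronHarrisGap h, fun _ => h⟩, fun h => h.2 h.1⟩

end Summit.CriticalPhenomena.PercolationContinuityZ3.Theorems.TetrahedronHarrisGap.Cert
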